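import Summits.QuantumFields.BalabanUV.Beta.GAN24.SliceFlatFreeHessian
import Summits.QuantumFields.BalabanUV.Beta.GAN24.Entry110GDivFlat

/-!
# G-an2-4 ∕ (CONV-C), the SECOND-ORDER sup entries of the requester's refined (B5-1115-TABLE) line — flat supplier, part 4 (END):
# block row sums of the SECOND unit differences of the flat `U = 1` propagator `gFlat j`, and of `gFlat j·∇_ν*·∇_μ*`, with
# exponential block decay and ONE logarithm: `≤ B₂·(1 + log L^j)·e^{−δ·nbd}`

G-an2-4 formalisation swarm `b2b-balaban-gan24-formalise-*`, leaf prover 03 (gen 48), crux team (2) under the coordinator ruling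
«YM REDIRECT» (e34b3e0c); last file of the chain `SliceFlatHeatSecond → SliceFlatHeatTorusSecond → SliceFlatFreeHessian →
SliceFlatHessian` (t4-ne3-p1's free-gradient chain `Support/SliceFlatHeatOneDim → … → SliceFlatGradient`, parts 7–13, ONE ORDER UP).
WHY — the road-P2 crux prover's refined request (gan24-p2 gen 29, journal `CLAIMS.log` l.28555): its exact two-level law for the
soft minimiser at `U = 1` costs «two second-order sup entries with a `log n` allowance: the row sums of `G∇*∇*`
(‖G′∂′ᴴ∂′ᴴ‖_{∞→∞} ≈ 1.44, 1.88, 2.30, 2.55 at n′ = 2, 4, 8, 12 — the expected log) and the pure second differences» — in print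
([B5] (1.112)) second-order entries cost a Hölder norm of the SOURCE; the sup → sup form with a logarithm is OUR statement.  THIS FILE
assembles both letters in the flat currency of the NE3 carrier `(ℤ/N·L^k)^{d+1} × Fin (d+1)` (ONE period: CUBIC tori):
 * §1 the weighted-row inputs one order up: (FF) `weightedRow_rowDiff_rowDiff_freeOp` — weighted rows of `∇_μ∇_ν F` are
   `≤ C·(1 + log L^j)` (part 3's `cubeSum_rowDiff_rowDiff_freeOp_le`, CUBE-LOCALISED ⇒ WEIGHTED), and its REFLECTED twin
   `weightedRow_transpose_rowDiff_rowDiff_freeOp` for `(∇_μ∇_ν F)ᵀ` (the free operator is a convolution kernel; leaf-04-g46's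
   reflection `z ↦ (2x₁ − z₁, z₂)` of `Entry110GDivFlat` §3);
 * §2 the resolvent identity of part 12 (`gFlat = F + F·W·gFlat`, `W = Wfl j` of weighted size `C_W·L^{−2j}`) ROW-DIFFERENCED TWICE,
   `∇_μ∇_ν gFlat = ∇_μ∇_ν F + (∇_μ∇_ν F)·W·gFlat` (`rowDiff_rowDiff_gFlat_eq`), and its TRANSPOSED form COLUMN-DIFFERENCED TWICE,
   **`gFlat·colDiff ν·colDiff μ = (∇_μ∇_ν F)ᵀ + gFlat·W·(∇_μ∇_ν F)ᵀ`** (`gFlat_mul_colDiff_mul_colDiff_eq`; `colDiff ν = ∂_νᴴ` as a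
   matrix, `mul_colDiff_apply`) — the second differences land on the FREE operator both times; the dictionary
   `(gFlat·colDiff ν·colDiff μ)(z,x) = ∇_μ∇_ν gFlat (x,z)` (`gFlat` symmetric);
 * §3 ENDs **`cubeSum_rowDiff_rowDiff_gFlat_le`** (ROW form — pure second differences: `Σ_{q : cubeI j q = y₁} |∇_μ∇_ν gFlat j (p,q)|`)
   and **`cubeSum_gFlat_mul_colDiff_mul_colDiff_le`** (the `G∇*∇*` letter — row sums of `gFlat j·∂_νᴴ·∂_μᴴ`, i.e. COLUMN sums of the
   Hessian kernel): `∃ B₂ δ > 0` (functions of `d`) with, for all `k N L`, `j ≤ k`, `μ ν`, `p`, `y₁`, both sums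
   `≤ B₂·(1 + log L^j)·e^{−δ·nbd_j(cubeI j p, y₁)}` — weighted rows are submultiplicative
   (`C_FF(1 + log L^j)·(1 + C_W L^{−2j}·C_G L^{2j})`) and WEIGHTED ⇒ CUBE-LOCALISED.  Against the landed first-order ENDs
   (`cubeSum_rowDiff_gFlat_le`, `cubeSum_gFlat_mul_colDiff_le`: `B·L^j`) the second order costs `L^{−j}·(1 + log L^j)` more —
   the kernel has `O(L^{2j})`, one difference `O(L^j)`, two differences `O(1 + log L^j)`.
Next (on the requester's word «which carrier»): the transport to pv15's `DeltaA n M 1` on cubic unit tori (leaf-04's §2∕§4 pattern of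
`Entry110GradCubic` ∕ `Entry110GDivCubic` over `GradientRowSumTransport`) or to NE2's scalar carriers.

HONEST SCOPE.  `U = 1`, flat; the NE3 carrier has ONE period (CUBIC tori); constants existential in `d` (NE3's `flatB₀, flatδ₀`, the
(3.49) entry bound `flatNg_le_349`, part 3's `106000·48^d`); nothing printed is asserted — [B5] `Balaban1984PropagatorsI` p. 35–36
(1.112) prints `|(∇G∇*J)(x)| ≤ O(1)e^{−δ₀|y−y′|}(‖J‖_ε + |J|)`, a Hölder-SOURCE bound, no logarithm: the typed inequalities are OURS, not
quotations.  NOT the Hölder letters (1.111)∕(1.115)–(1.117), NOT (E_P), NOT a ≠ 1; NOT (CONV-C), NEVER «G-an2-4 closed», NOT NE2 ∕ NE3,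
NOT D1, NOT BetaPertH, NOT continuum, NOT Clay; not in print — our bookkeeping.  ABSOLUTE RULE of the cell kept: every input is a
kernel-proved tree theorem used BY NAME (NE3 parts 11–13, leaf-04-g46's `Entry110GDivFlat` §1–§2, parts 1–3 of this chain); no `def`,
no `def … : Prop`, no `sorry`.  HONEST DEPENDENCY: continuum YM on T⁴ ⇐ BetaPertH ∧ nine spine estimates (0/9 proved); BetaPertH ⇐
(D1) ∧ (D4) ∧ CAP+tail; G-an2-4 gates asym, D1 and NE2/3/4.
-/

noncomputable section

open Real Finset Matrix

namespace Summit.QuantumFields.BalabanUV.Beta.GAN24.SliceFlatHessian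

open Literature.MathematicalPhysics.QuantumFieldTheory.Balaban1983to89
open Literature.MathematicalPhysics.QuantumFieldTheory.Balaban1983to89.TreeLengthTorus (TPt)
open Literature.MathematicalPhysics.QuantumFieldTheory.Balaban1983to89.B12Decay510Torus (pl1_sub_comm)
open Literature.MathematicalPhysics.QuantumFieldTheory.Balaban1983to89.T4SliceOperatorData (countConst countConst_pos)
open Summit.QuantumFields.BalabanUV.T4Continuum
open SliceTorusBlocks SliceTorusTower SliceCovariantModel SliceCovariantTower SliceFlatPropagator SliceFlatOperators SliceFlatStencil
open SliceFlatGaugeDecay SliceFlatFreeResolvent SliceFlatGradientPrep SliceFlatGradient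
open Summit.QuantumFields.BalabanUV.Beta.GAN24.SliceFlatFreeHessian
open Summit.QuantumFields.BalabanUV.Beta.GAN24.Entry110GDivFlat (Wfl_transpose gFlat_eq_freeT_add transpose_mul_colDiff)

variable (d k N L : ℕ)

/-! ## §1 The weighted-row inputs one order up -/
section Inputs

variable [NeZero N] [NeZero L]

/-- (FF) **Weighted rows of the free second differences `rowDiff μ (rowDiff ν (freeOp j))`** (`j ≤ k`, `0 ≤ δ < freeα d`):
`≤ 106000·48^d·(1 + log L^j)·e^{δ(d+1)}·2^{d+1}·countConst(freeα d − δ, d+1)` — from part 3. [folklore] -/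
theorem weightedRow_rowDiff_rowDiff_freeOp {j : ℕ} (hj : j ≤ k) (μ ν : Fin (d + 1)) {δ : ℝ} (hδ : 0 ≤ δ) (hδ₀ : δ < freeα d)
    (x : TPt (d + 1) (N * L ^ k) × Fin (d + 1)) :
    ∑ z, |rowDiff d k N L μ (rowDiff d k N L ν (freeOp d k N L j)) x z| * wE d k N L j δ x z
      ≤ 106000 * 48 ^ d * (1 + Real.log ((L : ℝ) ^ j)) * Real.exp (δ * (d + 1)) * ((2 : ℝ) ^ (d + 1) * countConst (freeα d - δ) (d + 1)) := by
  have hside : (side k L j : ℝ) = (L : ℝ) ^ j := by rw [SliceFlatMassTerm.side_eq_pow k L hj]; push_cast; rfl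
  have hn1 : (1 : ℝ) ≤ (side k L j : ℝ) := by exact_mod_cast one_le_side k L j
  have hlog : 0 ≤ 1 + Real.log ((L : ℝ) ^ j) := by rw [← hside]; have := Real.log_nonneg hn1; linarith
  refine weightedRow_of_cubeRows d k N L hj _ hδ hδ₀ (by positivity) x fun b => ?_
  rw [← hside]
  exact cubeSum_rowDiff_rowDiff_freeOp_le d k N L j μ ν x b

/-- (FFᵀ) **Weighted rows of `(rowDiff μ (rowDiff ν F))ᵀ` = weighted rows of `rowDiff μ (rowDiff ν F)`** (`F = freeOp j` is the
convolution kernel `[p₂ = q₂]·freeKer(p₁ − q₁)`; reflect the column site through the row site, `z ↦ (2x₁ − z₁, z₂)`, as in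
`Entry110GDivFlat.weightedRow_transpose_rowDiff_freeOp`), hence (FF) bounds them. [folklore] -/
theorem weightedRow_transpose_rowDiff_rowDiff_freeOp {j : ℕ} (hj : j ≤ k) (μ ν : Fin (d + 1)) {δ : ℝ} (hδ : 0 ≤ δ)
    (hδ₀ : δ < freeα d) (x : TPt (d + 1) (N * L ^ k) × Fin (d + 1)) :
    ∑ z, |(rowDiff d k N L μ (rowDiff d k N L ν (freeOp d k N L j))).transpose x z| * wE d k N L j δ x z
      ≤ 106000 * 48 ^ d * (1 + Real.log ((L : ℝ) ^ j)) * Real.exp (δ * (d + 1)) * ((2 : ℝ) ^ (d + 1) * countConst (freeα d - δ) (d + 1)) := by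
  -- the reflection of the site through `x₁`, an involution of the carrier
  let R : TPt (d + 1) (N * L ^ k) × Fin (d + 1) ≃ TPt (d + 1) (N * L ^ k) × Fin (d + 1) :=
    { toFun := fun z => (x.1 + x.1 - z.1, z.2)
      invFun := fun z => (x.1 + x.1 - z.1, z.2)
      left_inv := fun z => by simp only [sub_sub_cancel]
      right_inv := fun z => by simp only [sub_sub_cancel] }
  have hsum : ∑ z, |(rowDiff d k N L μ (rowDiff d k N L ν (freeOp d k N L j))).transpose x z| * wE d k N L j δ x z
      = ∑ z, |rowDiff d k N L μ (rowDiff d k N L ν (freeOp d k N L j)) x z| * wE d k N L j δ x z := by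
    refine Fintype.sum_equiv R _ _ fun z => ?_
    have hR : R z = (x.1 + x.1 - z.1, z.2) := rfl
    have h1 : (rowDiff d k N L μ (rowDiff d k N L ν (freeOp d k N L j))).transpose x z
        = rowDiff d k N L μ (rowDiff d k N L ν (freeOp d k N L j)) x (R z) := by
      rw [hR, Matrix.transpose_apply, rowDiff_rowDiff_apply, rowDiff_rowDiff_apply]
      simp only [freeOp]
      have e1 : z.1 + Pi.single μ 1 + Pi.single ν 1 - x.1 = x.1 + Pi.single μ 1 + Pi.single ν 1 - (x.1 + x.1 - z.1) := by abel
      have e2 : z.1 + Pi.single μ 1 - x.1 = x.1 + Pi.single μ 1 - (x.1 + x.1 - z.1) := by abel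
      have e3 : z.1 + Pi.single ν 1 - x.1 = x.1 + Pi.single ν 1 - (x.1 + x.1 - z.1) := by abel
      have e4 : z.1 - x.1 = x.1 - (x.1 + x.1 - z.1) := by abel
      rw [e1, e2, e3, e4]
      by_cases hc : z.2 = x.2
      · simp only [if_pos hc, if_pos hc.symm]
      · simp only [if_neg hc, if_neg (Ne.symm hc)]
    have h2 : wE d k N L j δ x z = wE d k N L j δ x (R z) := by
      rw [hR]
      simp only [wE, rhoI, rho]
      have e5 : x.1 - (x.1 + x.1 - z.1) = z.1 - x.1 := by abel
      rw [e5, pl1_sub_comm]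
    rw [h1, h2]
  rw [hsum]
  exact weightedRow_rowDiff_rowDiff_freeOp d k N L hj μ ν hδ hδ₀ x

end Inputs

/-! ## §2 The resolvent identity differenced twice: row form and transposed (column) form -/
section Identities

variable [NeZero N] [NeZero L]

/-- **The row-differenced (twice) resolvent identity**: `∇_μ∇_ν gFlat = ∇_μ∇_ν F + (∇_μ∇_ν F)·W·gFlat`. [folklore] -/
theorem rowDiff_rowDiff_gFlat_eq (j : ℕ) (μ ν : Fin (d + 1)) :
    rowDiff d k N L μ (rowDiff d k N L ν (gFlat d k N L j))
      = rowDiff d k N L μ (rowDiff d k N L ν (freeOp d k N L j))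
        + rowDiff d k N L μ (rowDiff d k N L ν (freeOp d k N L j)) * Wfl d k N L j * gFlat d k N L j := by
  conv_lhs => rw [gFlat_eq_free_add d k N L j]
  simp only [rowDiff_add, rowDiff_mul]

/-- **THE COLUMN-DIFFERENCED (TWICE) RESOLVENT IDENTITY**: `gFlat·colDiff ν·colDiff μ = (∇_μ∇_ν F)ᵀ + gFlat·W·(∇_μ∇_ν F)ᵀ` — both
column differences land on the FREE operator (`gFlat = Fᵀ + gFlat·W·Fᵀ`, `Aᵀ·colDiff ν = (rowDiff ν A)ᵀ` twice). [folklore] -/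
theorem gFlat_mul_colDiff_mul_colDiff_eq (j : ℕ) (μ ν : Fin (d + 1)) :
    gFlat d k N L j * colDiff d k N L ν * colDiff d k N L μ
      = (rowDiff d k N L μ (rowDiff d k N L ν (freeOp d k N L j))).transpose
        + gFlat d k N L j * Wfl d k N L j * (rowDiff d k N L μ (rowDiff d k N L ν (freeOp d k N L j))).transpose := by
  conv_lhs => rw [gFlat_eq_freeT_add d k N L j]
  rw [Matrix.add_mul, Matrix.add_mul, transpose_mul_colDiff, transpose_mul_colDiff,
    Matrix.mul_assoc (gFlat d k N L j * Wfl d k N L j), transpose_mul_colDiff,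
    Matrix.mul_assoc (gFlat d k N L j * Wfl d k N L j), transpose_mul_colDiff]

/-- The dictionary: **`(gFlat·colDiff ν·colDiff μ)(z,x) = ∇_μ∇_ν gFlat (x,z)`** — the row sums of `gFlat·∂_νᴴ·∂_μᴴ` are the COLUMN sums
of the Hessian kernel (`gFlat` symmetric). [folklore] -/
theorem gFlat_mul_colDiff_mul_colDiff_apply (j : ℕ) (μ ν : Fin (d + 1)) (z x : TPt (d + 1) (N * L ^ k) × Fin (d + 1)) :
    (gFlat d k N L j * colDiff d k N L ν * colDiff d k N L μ) z x = rowDiff d k N L μ (rowDiff d k N L ν (gFlat d k N L j)) x z := by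
  rw [mul_colDiff_apply, gFlat_mul_colDiff_apply, gFlat_mul_colDiff_apply]
  rfl

end Identities

/-! ## §3 ENDs: the second-order block row sums, `≤ B₂·(1 + log L^j)·e^{−δ·nbd}` -/
section Ends

/-- Both ENDs with common constants: the ROW form `Σ_{q ∈ Δ_j(y₁)} |∇_μ∇_ν gFlat j (p,q)|` and the `G∇*∇*` form
`Σ_{q ∈ Δ_j(y₁)} |(gFlat j·∂_νᴴ·∂_μᴴ)(p,q)|`. [folklore] -/
theorem cubeSum_second_order_gFlat_le :
    ∃ B₂ δ : ℝ, 0 < B₂ ∧ 0 < δ ∧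
      (∀ (k N L : ℕ) [NeZero N] [NeZero L] (j : ℕ), j ≤ k →
        ∀ (μ ν : Fin (d + 1)) (p : TPt (d + 1) (N * L ^ k) × Fin (d + 1)) (y₁ : TPt (d + 1) (levM k N L j)),
          ∑ q ∈ Finset.univ.filter (fun q => cubeI (d + 1) k N L (Fin (d + 1)) j q = y₁),
              |rowDiff d k N L μ (rowDiff d k N L ν (gFlat d k N L j)) p q|
            ≤ B₂ * (1 + Real.log ((L : ℝ) ^ j)) *
              Real.exp (-(δ * nbd (d + 1) k N L j (cubeI (d + 1) k N L (Fin (d + 1)) j p) y₁))) ∧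
      (∀ (k N L : ℕ) [NeZero N] [NeZero L] (j : ℕ), j ≤ k →
        ∀ (μ ν : Fin (d + 1)) (p : TPt (d + 1) (N * L ^ k) × Fin (d + 1)) (y₁ : TPt (d + 1) (levM k N L j)),
          ∑ q ∈ Finset.univ.filter (fun q => cubeI (d + 1) k N L (Fin (d + 1)) j q = y₁),
              |(gFlat d k N L j * colDiff d k N L ν * colDiff d k N L μ) p q|
            ≤ B₂ * (1 + Real.log ((L : ℝ) ^ j)) *
              Real.exp (-(δ * nbd (d + 1) k N L j (cubeI (d + 1) k N L (Fin (d + 1)) j p) y₁))) := by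
  obtain ⟨δ₁, C₁, hδ₁, hC₁, h349⟩ := flatNg_le_349 d
  obtain ⟨hα0, -⟩ := freeα_pos_le d
  have hf0 := flatδ₀_pos d
  set δ : ℝ := min (min (flatδ₀ d) (freeα d)) (δ₁ / 2) / 2 with hδdef
  have hmin : 0 < min (min (flatδ₀ d) (freeα d)) (δ₁ / 2) := lt_min (lt_min hf0 hα0) (by linarith)
  have hδ : 0 < δ := by rw [hδdef]; linarith
  have hδf : δ < flatδ₀ d := by
    have : min (min (flatδ₀ d) (freeα d)) (δ₁ / 2) ≤ flatδ₀ d := (min_le_left _ _).trans (min_le_left _ _)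
    rw [hδdef]; linarith
  have hδa : δ < freeα d := by
    have : min (min (flatδ₀ d) (freeα d)) (δ₁ / 2) ≤ freeα d := (min_le_left _ _).trans (min_le_right _ _)
    rw [hδdef]; linarith
  have hδ1 : δ < δ₁ / 2 := by
    have : min (min (flatδ₀ d) (freeα d)) (δ₁ / 2) ≤ δ₁ / 2 := min_le_right _ _
    rw [hδdef]; linarith
  set KK : ℝ := Real.exp (δ * (d + 1)) * (2 : ℝ) ^ (d + 1) with hKK
  set CG : ℝ := flatB₀ d * KK * countConst (flatδ₀ d - δ) (d + 1) with hCG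
  set CF : ℝ := 106000 * 48 ^ d * KK * countConst (freeα d - δ) (d + 1) with hCF
  set CW : ℝ := 1 + ((d : ℝ) + 1) * KK * countConst 1 (d + 1) + ((d : ℝ) + 1) * C₁ * KK * countConst (δ₁ / 2 - δ) (d + 1)
    with hCW
  have hKK0 : 0 < KK := by rw [hKK]; positivity
  have hcG := countConst_pos (sub_pos.2 hδf) (d + 1)
  have hcF := countConst_pos (sub_pos.2 hδa) (d + 1)
  have hc1 := countConst_pos one_pos (d + 1)
  have hcW := countConst_pos (sub_pos.2 hδ1) (d + 1)
  have hCG0 : 0 ≤ CG := by rw [hCG]; exact mul_nonneg (mul_nonneg (flatB₀_nonneg d) hKK0.le) hcG.le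
  have hCF0 : 0 < CF := by rw [hCF]; positivity
  have hCW0 : 0 ≤ CW := by rw [hCW]; positivity
  refine ⟨CF * (1 + CW * CG) * Real.exp (δ * (d + 1)), δ, by positivity, hδ, fun k N L _ _ j hj μ ν p y₁ => ?_,
    fun k N L _ _ j hj μ ν p y₁ => ?_⟩
  · -- ROW form
    have hL : (0 : ℝ) < (L : ℝ) := by exact_mod_cast Nat.pos_of_ne_zero (NeZero.ne L)
    have hLj : (0 : ℝ) < (L : ℝ) ^ j := pow_pos hL j
    have hlog : 0 ≤ 1 + Real.log ((L : ℝ) ^ j) := by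
      have := Real.log_nonneg (one_le_pow₀ (show (1 : ℝ) ≤ L by exact_mod_cast Nat.pos_of_ne_zero (NeZero.ne L)) : (1 : ℝ) ≤ (L : ℝ) ^ j)
      linarith
    obtain ⟨hEpos, hEtri, -⟩ := wE_facts d k N L j hδ.le
    have hG : ∀ x, ∑ z, |gFlat d k N L j x z| * wE d k N L j δ x z ≤ CG * ((L : ℝ) ^ j) ^ 2 := fun x =>
      (weightedRow_gFlat d k N L hj hδ.le hδf x).trans (le_of_eq (by rw [hCG, hKK]; ring))
    have hF : ∀ x, ∑ z, |rowDiff d k N L μ (rowDiff d k N L ν (freeOp d k N L j)) x z| * wE d k N L j δ x z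
        ≤ CF * (1 + Real.log ((L : ℝ) ^ j)) := fun x =>
      (weightedRow_rowDiff_rowDiff_freeOp d k N L hj μ ν hδ.le hδa x).trans (le_of_eq (by rw [hCF, hKK]; ring))
    have hW : ∀ x, ∑ z, |Wfl d k N L j x z| * wE d k N L j δ x z ≤ CW * (((L : ℝ) ^ j) ^ 2)⁻¹ := fun x =>
      (weightedRow_Wfl d k N L hj hδ.le hδ1 hC₁.le (h349 k N L j hj) x).trans (le_of_eq (by rw [hCW, hKK]; ring))
    have hFW : ∀ x, ∑ z, |(rowDiff d k N L μ (rowDiff d k N L ν (freeOp d k N L j)) * Wfl d k N L j) x z| * wE d k N L j δ x z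
        ≤ (CF * (1 + Real.log ((L : ℝ) ^ j))) * (CW * (((L : ℝ) ^ j) ^ 2)⁻¹) :=
      weightedRow_mul_le _ _ _ (by positivity) (fun x z => (hEpos x z).le) hEtri hF hW
    have hFWG : ∀ x, ∑ z, |(rowDiff d k N L μ (rowDiff d k N L ν (freeOp d k N L j)) * Wfl d k N L j * gFlat d k N L j) x z|
          * wE d k N L j δ x z
        ≤ ((CF * (1 + Real.log ((L : ℝ) ^ j))) * (CW * (((L : ℝ) ^ j) ^ 2)⁻¹)) * (CG * ((L : ℝ) ^ j) ^ 2) :=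
      weightedRow_mul_le _ _ _ (by positivity) (fun x z => (hEpos x z).le) hEtri hFW hG
    have hrow : ∑ z, |rowDiff d k N L μ (rowDiff d k N L ν (gFlat d k N L j)) p z| * wE d k N L j δ p z
        ≤ CF * (1 + CW * CG) * (1 + Real.log ((L : ℝ) ^ j)) := by
      rw [rowDiff_rowDiff_gFlat_eq]
      calc ∑ z, |(rowDiff d k N L μ (rowDiff d k N L ν (freeOp d k N L j))
              + rowDiff d k N L μ (rowDiff d k N L ν (freeOp d k N L j)) * Wfl d k N L j * gFlat d k N L j) p z| * wE d k N L j δ p z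
          ≤ ∑ z, (|rowDiff d k N L μ (rowDiff d k N L ν (freeOp d k N L j)) p z| * wE d k N L j δ p z
              + |(rowDiff d k N L μ (rowDiff d k N L ν (freeOp d k N L j)) * Wfl d k N L j * gFlat d k N L j) p z|
                * wE d k N L j δ p z) := by
            refine Finset.sum_le_sum fun z _ => ?_
            rw [Matrix.add_apply, ← add_mul]
            exact mul_le_mul_of_nonneg_right (abs_add_le _ _) (hEpos p z).le
        _ ≤ CF * (1 + Real.log ((L : ℝ) ^ j))
              + ((CF * (1 + Real.log ((L : ℝ) ^ j))) * (CW * (((L : ℝ) ^ j) ^ 2)⁻¹)) * (CG * ((L : ℝ) ^ j) ^ 2) := by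
            rw [Finset.sum_add_distrib]; exact add_le_add (hF p) (hFWG p)
        _ = CF * (1 + CW * CG) * (1 + Real.log ((L : ℝ) ^ j)) := by field_simp
    have h := cubeSum_le_of_weightedRow d k N L j (rowDiff d k N L μ (rowDiff d k N L ν (gFlat d k N L j))) hδ.le p hrow y₁
    calc _ ≤ _ := h
      _ = _ := by ring
  · -- `G∇*∇*` form
    have hL : (0 : ℝ) < (L : ℝ) := by exact_mod_cast Nat.pos_of_ne_zero (NeZero.ne L)
    have hLj : (0 : ℝ) < (L : ℝ) ^ j := pow_pos hL j
    have hlog : 0 ≤ 1 + Real.log ((L : ℝ) ^ j) := by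
      have := Real.log_nonneg (one_le_pow₀ (show (1 : ℝ) ≤ L by exact_mod_cast Nat.pos_of_ne_zero (NeZero.ne L)) : (1 : ℝ) ≤ (L : ℝ) ^ j)
      linarith
    obtain ⟨hEpos, hEtri, -⟩ := wE_facts d k N L j hδ.le
    have hG : ∀ x, ∑ z, |gFlat d k N L j x z| * wE d k N L j δ x z ≤ CG * ((L : ℝ) ^ j) ^ 2 := fun x =>
      (weightedRow_gFlat d k N L hj hδ.le hδf x).trans (le_of_eq (by rw [hCG, hKK]; ring))
    have hFT : ∀ x, ∑ z, |(rowDiff d k N L μ (rowDiff d k N L ν (freeOp d k N L j))).transpose x z| * wE d k N L j δ x z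
        ≤ CF * (1 + Real.log ((L : ℝ) ^ j)) := fun x =>
      (weightedRow_transpose_rowDiff_rowDiff_freeOp d k N L hj μ ν hδ.le hδa x).trans (le_of_eq (by rw [hCF, hKK]; ring))
    have hW : ∀ x, ∑ z, |Wfl d k N L j x z| * wE d k N L j δ x z ≤ CW * (((L : ℝ) ^ j) ^ 2)⁻¹ := fun x =>
      (weightedRow_Wfl d k N L hj hδ.le hδ1 hC₁.le (h349 k N L j hj) x).trans (le_of_eq (by rw [hCW, hKK]; ring))
    have hGW : ∀ x, ∑ z, |(gFlat d k N L j * Wfl d k N L j) x z| * wE d k N L j δ x z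
        ≤ (CG * ((L : ℝ) ^ j) ^ 2) * (CW * (((L : ℝ) ^ j) ^ 2)⁻¹) :=
      weightedRow_mul_le _ _ _ (by positivity) (fun x z => (hEpos x z).le) hEtri hG hW
    have hGWF : ∀ x, ∑ z, |(gFlat d k N L j * Wfl d k N L j
          * (rowDiff d k N L μ (rowDiff d k N L ν (freeOp d k N L j))).transpose) x z| * wE d k N L j δ x z
        ≤ ((CG * ((L : ℝ) ^ j) ^ 2) * (CW * (((L : ℝ) ^ j) ^ 2)⁻¹)) * (CF * (1 + Real.log ((L : ℝ) ^ j))) :=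
      weightedRow_mul_le _ _ _ (by positivity) (fun x z => (hEpos x z).le) hEtri hGW hFT
    have hrow : ∑ z, |(gFlat d k N L j * colDiff d k N L ν * colDiff d k N L μ) p z| * wE d k N L j δ p z
        ≤ CF * (1 + CW * CG) * (1 + Real.log ((L : ℝ) ^ j)) := by
      rw [gFlat_mul_colDiff_mul_colDiff_eq]
      calc ∑ z, |((rowDiff d k N L μ (rowDiff d k N L ν (freeOp d k N L j))).transpose
              + gFlat d k N L j * Wfl d k N L j * (rowDiff d k N L μ (rowDiff d k N L ν (freeOp d k N L j))).transpose) p z|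
              * wE d k N L j δ p z
          ≤ ∑ z, (|(rowDiff d k N L μ (rowDiff d k N L ν (freeOp d k N L j))).transpose p z| * wE d k N L j δ p z
              + |(gFlat d k N L j * Wfl d k N L j * (rowDiff d k N L μ (rowDiff d k N L ν (freeOp d k N L j))).transpose) p z|
                * wE d k N L j δ p z) := by
            refine Finset.sum_le_sum fun z _ => ?_
            rw [Matrix.add_apply, ← add_mul]
            exact mul_le_mul_of_nonneg_right (abs_add_le _ _) (hEpos p z).le
        _ ≤ CF * (1 + Real.log ((L : ℝ) ^ j))
              + ((CG * ((L : ℝ) ^ j) ^ 2) * (CW * (((L : ℝ) ^ j) ^ 2)⁻¹)) * (CF * (1 + Real.log ((L : ℝ) ^ j))) := by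
            rw [Finset.sum_add_distrib]; exact add_le_add (hFT p) (hGWF p)
        _ = CF * (1 + CW * CG) * (1 + Real.log ((L : ℝ) ^ j)) := by field_simp
    have h := cubeSum_le_of_weightedRow d k N L j (gFlat d k N L j * colDiff d k N L ν * colDiff d k N L μ) hδ.le p hrow y₁
    calc _ ≤ _ := h
      _ = _ := by ring

/-- **END 1 — PURE SECOND DIFFERENCES, ROW FORM**: there are `B₂, δ > 0` (functions of `d` only) such that for all `k N L`, every
level `j ≤ k`, directions `μ, ν`, row `p` and block `y₁`,
`Σ_{q : cubeI j q = y₁} |∇_μ∇_ν gFlat j (p, q)| ≤ B₂·(1 + log L^j)·e^{−δ·nbd_j(cubeI j p, y₁)}`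
(`∇_μ∇_ν gFlat j (p,q) = gFlat j (p+e_μ+e_ν, q) − gFlat j (p+e_μ, q) − gFlat j (p+e_ν, q) + gFlat j (p, q)`). [folklore] -/
theorem cubeSum_rowDiff_rowDiff_gFlat_le :
    ∃ B₂ δ : ℝ, 0 < B₂ ∧ 0 < δ ∧ ∀ (k N L : ℕ) [NeZero N] [NeZero L] (j : ℕ), j ≤ k →
      ∀ (μ ν : Fin (d + 1)) (p : TPt (d + 1) (N * L ^ k) × Fin (d + 1)) (y₁ : TPt (d + 1) (levM k N L j)),
        ∑ q ∈ Finset.univ.filter (fun q => cubeI (d + 1) k N L (Fin (d + 1)) j q = y₁),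
            |rowDiff d k N L μ (rowDiff d k N L ν (gFlat d k N L j)) p q|
          ≤ B₂ * (1 + Real.log ((L : ℝ) ^ j)) *
            Real.exp (-(δ * nbd (d + 1) k N L j (cubeI (d + 1) k N L (Fin (d + 1)) j p) y₁)) := by
  obtain ⟨B₂, δ, hB₂, hδ, hrow, -⟩ := cubeSum_second_order_gFlat_le d
  exact ⟨B₂, δ, hB₂, hδ, hrow⟩

/-- **END 2 — THE `G∇*∇*` LETTER** (row sums of `gFlat j·∂_νᴴ·∂_μᴴ`, i.e. COLUMN sums of the Hessian kernel, the requester's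
`‖G′∂′ᴴ∂′ᴴ‖_{∞→∞}` localised to blocks): with the same constants,
`Σ_{q : cubeI j q = y₁} |(gFlat j·colDiff ν·colDiff μ)(p, q)| ≤ B₂·(1 + log L^j)·e^{−δ·nbd_j(cubeI j p, y₁)}`. [folklore] -/
theorem cubeSum_gFlat_mul_colDiff_mul_colDiff_le :
    ∃ B₂ δ : ℝ, 0 < B₂ ∧ 0 < δ ∧ ∀ (k N L : ℕ) [NeZero N] [NeZero L] (j : ℕ), j ≤ k →
      ∀ (μ ν : Fin (d + 1)) (p : TPt (d + 1) (N * L ^ k) × Fin (d + 1)) (y₁ : TPt (d + 1) (levM k N L j)),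
        ∑ q ∈ Finset.univ.filter (fun q => cubeI (d + 1) k N L (Fin (d + 1)) j q = y₁),
            |(gFlat d k N L j * colDiff d k N L ν * colDiff d k N L μ) p q|
          ≤ B₂ * (1 + Real.log ((L : ℝ) ^ j)) *
            Real.exp (-(δ * nbd (d + 1) k N L j (cubeI (d + 1) k N L (Fin (d + 1)) j p) y₁)) := by
  obtain ⟨B₂, δ, hB₂, hδ, -, hcol⟩ := cubeSum_second_order_gFlat_le d
  exact ⟨B₂, δ, hB₂, hδ, hcol⟩

end Ends

end Summit.QuantumFields.BalabanUV.Beta.GAN24.SliceFlatHessian
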